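import Summits.QuantumAdvantage.QuantumAdvantage.Theorems.LinnikCubicClassGroupsDegreeOnePrimesEscapeConjClassShortIntervalDHCorollaries
import HarnessLib

/-!
# The Chebotarev density theorem in short intervals: the prime-count form

Topic `Summits/QuantumAdvantage/QuantumAdvantage/Theorems`, cell B2b-1 (linnik-cubic), PART A (gen 19); helper toward the
crux `DegreeOnePrimesEscape` (stmt-QuantumAdvantage-11543) of route `LinnikCubicClassGroups`.  HONEST FRAMING: the value
of this file is a THEOREM (kernel-checked, GRH-free, Siegel-free) — NOT summit progress.

`frobeniusClass_shortInterval_count`: the `π`-form of the Deuring–Heilbronn-sharp short-interval Chebotarev theorem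
`frobeniusClass_shortInterval_dh` (gen 17).  For `n > 1`, `κ > 0` there are `δ ≤ 1/64`, `L`, `c` such that for every
Galois `N/ℚ` of degree `n`, every `σ`, `x ≥ |d_N|^L`, `x^{1−δ} ≤ h ≤ x`, with
`N_C(x, h) = #{x < p ≤ x + h : p ∤ d_N, Frob_p ∈ C(σ)}`, `δ_C = |C|/|G|`, `I = ∫_x^{x+h} t^{β₁−1} dt`:
(A) no real zero of `ζ_N` in `(1 − c/(log|d_N| + log 4), 1)` ⟹ `|N_C log x − δ_C h| ≤ κ δ_C h`;
(B) `β₁` such a zero ⟹ `|N_C log x − δ_C (h − I)| ≤ κ δ_C (h − I)` if `ζ_{N^⟨σ⟩}(β₁) = 0` (relative, flat), and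
`|N_C log x − δ_C (h + I)| ≤ κ δ_C h` otherwise — i.e. `N_C = (1 ± κ) δ_C (h ∓ I)/log x`.  Unconditional.
The passage from `Σ log p` to the count costs a factor `log(x+h)/log x ≤ 1 + log 2/log x`, absorbed into `κ` for
`x ≥ |d_N|^L`.
References: A. Balog, K. Ono, J. Number Theory 91 (2001); S. Gun, S. L. Naik, arXiv:2405.04698, Thm. 7 (absolute error);
[LagariasMontgomeryOdlyzko1979, Thm. 1.1]; [ThornerZaman2019, Thm. 3.1].
-/

noncomputable section

open scoped NumberField nonZeroDivisors Classical
open Finset Real Ideal NumberField IsDedekindDomain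
open Literature.NumberTheory.NumberFields Literature.NumberTheory.LFunctions
  Literature.NumberTheory.LFunctions.NumberField Literature.NumberTheory.GaloisRepresentations

namespace Summit.QuantumAdvantage.QuantumAdvantage.Theorems.DegreeOnePrimesEscape

/-! ### `log`-weighted prime sums versus prime counts over `(x, x+h]` -/

/-- For a prime predicate `P`, `0 ≤ x`, `0 ≤ h`: with `S(y) = Σ_{p ≤ y, P p} log p` and `N(y) = #{p ≤ y : P p}`,
`(N(x+h) − N(x))·log x ≤ S(x+h) − S(x) ≤ (N(x+h) − N(x))·log(x+h)`. [folklore] -/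
theorem primesLE_logSum_sub_mem {P : ℕ → Prop} [DecidablePred P] {x h : ℝ} (hx : 0 < x) (hh : 0 ≤ h) :
    ((((Nat.primesLE ⌊x + h⌋₊).filter P).card : ℝ) - ((Nat.primesLE ⌊x⌋₊).filter P).card) * Real.log x ≤
        (∑ p ∈ (Nat.primesLE ⌊x + h⌋₊).filter P, Real.log p) - ∑ p ∈ (Nat.primesLE ⌊x⌋₊).filter P, Real.log p ∧
      (∑ p ∈ (Nat.primesLE ⌊x + h⌋₊).filter P, Real.log p) - ∑ p ∈ (Nat.primesLE ⌊x⌋₊).filter P, Real.log p ≤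
        ((((Nat.primesLE ⌊x + h⌋₊).filter P).card : ℝ) - ((Nat.primesLE ⌊x⌋₊).filter P).card) * Real.log (x + h) := by
  set S := (Nat.primesLE ⌊x⌋₊).filter P with hS
  set T := (Nat.primesLE ⌊x + h⌋₊).filter P with hT
  have hsub : S ⊆ T := by
    intro p hp
    rw [hS, Finset.mem_filter, Nat.primesLE_eq_filter_range, Finset.mem_filter, Finset.mem_range] at hp
    rw [hT, Finset.mem_filter, Nat.primesLE_eq_filter_range, Finset.mem_filter, Finset.mem_range]
    refine ⟨⟨?_, hp.1.2⟩, hp.2⟩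
    have : ⌊x⌋₊ ≤ ⌊x + h⌋₊ := Nat.floor_le_floor (by linarith)
    omega
  have hcard : ((T \ S).card : ℝ) = (T.card : ℝ) - S.card := by
    rw [Finset.card_sdiff_of_subset hsub, Nat.cast_sub (Finset.card_le_card hsub)]
  rw [← Finset.sum_sdiff hsub, add_sub_cancel_right, ← hcard]
  have hmem : ∀ p ∈ T \ S, x < (p : ℝ) ∧ (p : ℝ) ≤ x + h := by
    intro p hp
    rw [Finset.mem_sdiff, hT, Finset.mem_filter, Nat.primesLE_eq_filter_range, Finset.mem_filter, Finset.mem_range] at hp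
    obtain ⟨⟨⟨hple, hprime⟩, hPp⟩, hnot⟩ := hp
    have hpgt : ⌊x⌋₊ < p := by
      by_contra hle
      rw [not_lt] at hle
      exact hnot (by
        rw [hS, Finset.mem_filter, Nat.primesLE_eq_filter_range, Finset.mem_filter, Finset.mem_range]
        exact ⟨⟨by omega, hprime⟩, hPp⟩)
    refine ⟨Nat.lt_of_floor_lt hpgt, ?_⟩
    have : (p : ℝ) ≤ ⌊x + h⌋₊ := by exact_mod_cast Nat.le_of_lt_succ hple
    exact this.trans (Nat.floor_le (by linarith))
  constructor
  · have h := Finset.card_nsmul_le_sum (T \ S) (fun p : ℕ ↦ Real.log p) (Real.log x) (fun p hp ↦ ?_)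
    · rwa [nsmul_eq_mul] at h
    · exact Real.log_le_log hx (hmem p hp).1.le
  · have h := Finset.sum_le_card_nsmul (T \ S) (fun p : ℕ ↦ Real.log p) (Real.log (x + h)) (fun p hp ↦ ?_)
    · rwa [nsmul_eq_mul] at h
    · exact Real.log_le_log (by linarith [(hmem p hp).1]) (hmem p hp).2

set_option maxHeartbeats 3200000 in
/-- **The Chebotarev density theorem in short intervals of the Linnik range, prime-count form, Deuring–Heilbronn-sharp,
every conjugacy class of every Galois number field** (see the module docstring). Unconditional.
[cite: LagariasMontgomeryOdlyzko1979, Theorem 1.1] [cite: ThornerZaman2019, Theorem 3.1] -/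
theorem frobeniusClass_shortInterval_count (n : ℕ) (hn : 1 < n) {κ : ℝ} (hκ : 0 < κ) :
    ∃ δ L c : ℝ, 0 < δ ∧ δ ≤ 1 / 64 ∧ 0 < L ∧ 0 < c ∧ c ≤ 1 / 4 ∧ c ≤ 1 / (8 * ((2 * n).factorial : ℝ)) ∧
      ∀ (N : Type) [Field N] [NumberField N] [IsGalois ℚ N], Module.finrank ℚ N = n → ∀ σ : N ≃ₐ[ℚ] N,
      ∀ x h : ℝ, ((NumberField.discr N).natAbs : ℝ) ^ L ≤ x → x ^ (1 - δ) ≤ h → h ≤ x →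
        ((¬ ∃ β₁ : ℝ, dedekindZeta₁ N β₁ = 0 ∧
            1 - c / (Real.log ((NumberField.discr N).natAbs : ℝ) + Real.log 4) < β₁ ∧ β₁ < 1) →
            |((((Nat.primesLE ⌊x + h⌋₊).filter
                (fun p : ℕ => ¬ ((p : ℤ) ∣ NumberField.discr N) ∧
                  ∃ (Q : Ideal (𝓞 N)) (_ : Q.IsMaximal) (_ : Q.LiesOver (span {(p : ℤ)})) (φ g : N ≃ₐ[ℚ] N),
                    IsArithFrobAt ℤ φ Q ∧ Q.inertia (N ≃ₐ[ℚ] N) = ⊥ ∧ g * φ * g⁻¹ = σ)).card : ℝ) -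
              ((Nat.primesLE ⌊x⌋₊).filter
                (fun p : ℕ => ¬ ((p : ℤ) ∣ NumberField.discr N) ∧
                  ∃ (Q : Ideal (𝓞 N)) (_ : Q.IsMaximal) (_ : Q.LiesOver (span {(p : ℤ)})) (φ g : N ≃ₐ[ℚ] N),
                    IsArithFrobAt ℤ φ Q ∧ Q.inertia (N ≃ₐ[ℚ] N) = ⊥ ∧ g * φ * g⁻¹ = σ)).card) * Real.log x -
              (Nat.card {τ : N ≃ₐ[ℚ] N // IsConj σ τ} : ℝ) / Nat.card (N ≃ₐ[ℚ] N) * h| ≤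
              κ * ((Nat.card {τ : N ≃ₐ[ℚ] N // IsConj σ τ} : ℝ) / Nat.card (N ≃ₐ[ℚ] N) * h)) ∧
        (∀ β₁ : ℝ, dedekindZeta₁ N β₁ = 0 →
          1 - c / (Real.log ((NumberField.discr N).natAbs : ℝ) + Real.log 4) < β₁ → β₁ < 1 →
          (dedekindZeta₁ (IntermediateField.fixedField (Subgroup.zpowers σ)) β₁ = 0 →
              |((((Nat.primesLE ⌊x + h⌋₊).filter
                  (fun p : ℕ => ¬ ((p : ℤ) ∣ NumberField.discr N) ∧
                    ∃ (Q : Ideal (𝓞 N)) (_ : Q.IsMaximal) (_ : Q.LiesOver (span {(p : ℤ)})) (φ g : N ≃ₐ[ℚ] N),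
                      IsArithFrobAt ℤ φ Q ∧ Q.inertia (N ≃ₐ[ℚ] N) = ⊥ ∧ g * φ * g⁻¹ = σ)).card : ℝ) -
                ((Nat.primesLE ⌊x⌋₊).filter
                  (fun p : ℕ => ¬ ((p : ℤ) ∣ NumberField.discr N) ∧
                    ∃ (Q : Ideal (𝓞 N)) (_ : Q.IsMaximal) (_ : Q.LiesOver (span {(p : ℤ)})) (φ g : N ≃ₐ[ℚ] N),
                      IsArithFrobAt ℤ φ Q ∧ Q.inertia (N ≃ₐ[ℚ] N) = ⊥ ∧ g * φ * g⁻¹ = σ)).card) * Real.log x -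
                (Nat.card {τ : N ≃ₐ[ℚ] N // IsConj σ τ} : ℝ) / Nat.card (N ≃ₐ[ℚ] N) *
                  (h - ((x + h) ^ β₁ - x ^ β₁) / β₁)| ≤
                κ * ((Nat.card {τ : N ≃ₐ[ℚ] N // IsConj σ τ} : ℝ) / Nat.card (N ≃ₐ[ℚ] N) *
                  (h - ((x + h) ^ β₁ - x ^ β₁) / β₁))) ∧
          (dedekindZeta₁ (IntermediateField.fixedField (Subgroup.zpowers σ)) β₁ ≠ 0 →
              |((((Nat.primesLE ⌊x + h⌋₊).filter
                  (fun p : ℕ => ¬ ((p : ℤ) ∣ NumberField.discr N) ∧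
                    ∃ (Q : Ideal (𝓞 N)) (_ : Q.IsMaximal) (_ : Q.LiesOver (span {(p : ℤ)})) (φ g : N ≃ₐ[ℚ] N),
                      IsArithFrobAt ℤ φ Q ∧ Q.inertia (N ≃ₐ[ℚ] N) = ⊥ ∧ g * φ * g⁻¹ = σ)).card : ℝ) -
                ((Nat.primesLE ⌊x⌋₊).filter
                  (fun p : ℕ => ¬ ((p : ℤ) ∣ NumberField.discr N) ∧
                    ∃ (Q : Ideal (𝓞 N)) (_ : Q.IsMaximal) (_ : Q.LiesOver (span {(p : ℤ)})) (φ g : N ≃ₐ[ℚ] N),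
                      IsArithFrobAt ℤ φ Q ∧ Q.inertia (N ≃ₐ[ℚ] N) = ⊥ ∧ g * φ * g⁻¹ = σ)).card) * Real.log x -
                (Nat.card {τ : N ≃ₐ[ℚ] N // IsConj σ τ} : ℝ) / Nat.card (N ≃ₐ[ℚ] N) *
                  (h + ((x + h) ^ β₁ - x ^ β₁) / β₁)| ≤
                κ * ((Nat.card {τ : N ≃ₐ[ℚ] N // IsConj σ τ} : ℝ) / Nat.card (N ≃ₐ[ℚ] N) * h))) := by
  -- the `log`-weighted theorem at precision `κ' = min(κ,1)/4`; `log 2 ≤ κ' log x` from `x ≥ 3^L`, `L ≥ 1/κ'`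
  set κ' : ℝ := min κ 1 / 4 with hκ'
  have hκ'0 : 0 < κ' := by rw [hκ']; exact div_pos (lt_min hκ one_pos) (by norm_num)
  have hκ'κ : κ' ≤ κ / 4 := by rw [hκ']; exact div_le_div_of_nonneg_right (min_le_left _ _) (by norm_num)
  have hκ'1 : κ' ≤ 1 / 4 := by rw [hκ']; exact div_le_div_of_nonneg_right (min_le_right _ _) (by norm_num)
  obtain ⟨δ, L, c, hδ0, hδ64, hL0, hc0, hc4, hcfac, hmain⟩ :=
    frobeniusClass_shortInterval_dh n hn hκ'0 (by linarith)
  refine ⟨δ, max L (1 / κ'), c, hδ0, hδ64, lt_max_of_lt_left hL0, hc0, hc4, hcfac,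
    fun N _ _ _ hN σ x h hx hhx hhx' => ?_⟩
  have hN1 : 1 < Module.finrank ℚ N := by rw [hN]; exact hn
  set d : ℝ := ((NumberField.discr N).natAbs : ℝ) with hd
  have hd3 : (3 : ℝ) ≤ d := three_le_natAbs_discr_real N hN1
  have hd1 : (1 : ℝ) ≤ d := by linarith
  have hxL : d ^ L ≤ x := (Real.rpow_le_rpow_of_exponent_le hd1 (le_max_left _ _)).trans hx
  have hx1 : 1 < x := by
    have h1 : (3 : ℝ) ^ L ≤ d ^ L := Real.rpow_le_rpow (by norm_num) hd3 hL0.le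
    have h2 : (1 : ℝ) < (3 : ℝ) ^ L := Real.one_lt_rpow (by norm_num) hL0
    linarith
  have hx0 : 0 < x := by linarith
  have hh0 : 0 < h := lt_of_lt_of_le (Real.rpow_pos_of_pos hx0 _) hhx
  have hlogx0 : 0 < Real.log x := Real.log_pos hx1
  -- `log 2 ≤ κ' log x`
  have hρκ : Real.log 2 ≤ κ' * Real.log x := by
    have h1 := Real.log_le_log (Real.rpow_pos_of_pos (by linarith) _) hx
    rw [Real.log_rpow (by linarith)] at h1
    have hlog3 : 1 ≤ Real.log d := by
      have : 1 ≤ Real.log 3 := by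
        rw [Real.le_log_iff_exp_le (by norm_num)]; have := Real.exp_one_lt_d9; linarith
      exact this.trans (Real.log_le_log (by norm_num) hd3)
    have h2 : 1 / κ' ≤ max L (1 / κ') * Real.log d :=
      le_trans (le_max_right _ _) (le_mul_of_one_le_right (by positivity) hlog3)
    have hlog2 : Real.log 2 < 0.6931471808 := Real.log_two_lt_d9
    have h3 : κ' * (1 / κ') = 1 := by field_simp
    nlinarith
  obtain ⟨hA, hB⟩ := hmain N hN σ x h hxL hhx hhx'
  set P : ℕ → Prop := fun p : ℕ => ¬ ((p : ℤ) ∣ NumberField.discr N) ∧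
    ∃ (Q : Ideal (𝓞 N)) (_ : Q.IsMaximal) (_ : Q.LiesOver (span {(p : ℤ)})) (φ g : N ≃ₐ[ℚ] N),
      IsArithFrobAt ℤ φ Q ∧ Q.inertia (N ≃ₐ[ℚ] N) = ⊥ ∧ g * φ * g⁻¹ = σ with hP
  set Nc : ℝ := ((((Nat.primesLE ⌊x + h⌋₊).filter P).card : ℝ) - ((Nat.primesLE ⌊x⌋₊).filter P).card) with hNc
  set ΔS : ℝ := (∑ p ∈ (Nat.primesLE ⌊x + h⌋₊).filter P, Real.log p) -
    ∑ p ∈ (Nat.primesLE ⌊x⌋₊).filter P, Real.log p with hΔS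
  set δC : ℝ := (Nat.card {τ : N ≃ₐ[ℚ] N // IsConj σ τ} : ℝ) / Nat.card (N ≃ₐ[ℚ] N) with hδC
  have hδC0 : 0 < δC := by
    have h1 : 0 < Nat.card {τ : N ≃ₐ[ℚ] N // IsConj σ τ} := by
      haveI : Nonempty {τ : N ≃ₐ[ℚ] N // IsConj σ τ} := ⟨⟨σ, IsConj.refl σ⟩⟩
      exact Nat.card_pos
    have h2 : 0 < Nat.card (N ≃ₐ[ℚ] N) := Nat.card_pos
    exact div_pos (by exact_mod_cast h1) (by exact_mod_cast h2)
  obtain ⟨hlo, hup⟩ := primesLE_logSum_sub_mem (P := P) hx0 hh0.le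
  rw [← hNc, ← hΔS] at hlo hup
  have hlogxh : Real.log (x + h) ≤ Real.log x + Real.log 2 := by
    have h1 : Real.log (x + h) ≤ Real.log (2 * x) := Real.log_le_log (by linarith) (by linarith)
    rw [Real.log_mul (by norm_num) hx0.ne'] at h1; linarith
  have hNc0 : 0 ≤ Nc := by
    rw [hNc, sub_nonneg]
    exact_mod_cast Finset.card_le_card (fun p hp ↦ by
      rw [Finset.mem_filter, Nat.primesLE_eq_filter_range, Finset.mem_filter, Finset.mem_range] at hp ⊢
      refine ⟨⟨?_, hp.1.2⟩, hp.2⟩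
      have : ⌊x⌋₊ ≤ ⌊x + h⌋₊ := Nat.floor_le_floor (by linarith)
      omega)
  have hΔN : ΔS ≤ Nc * Real.log x + Nc * (κ' * Real.log x) := by
    have := mul_le_mul_of_nonneg_left (hlogxh.trans (by linarith : Real.log x + Real.log 2 ≤ Real.log x + κ' * Real.log x)) hNc0
    linarith
  have hsand : ΔS - κ' * ΔS ≤ Nc * Real.log x ∧ Nc * Real.log x ≤ ΔS := by
    constructor
    · have hΔ0 : 0 ≤ ΔS := le_trans (mul_nonneg hNc0 hlogx0.le) hlo
      nlinarith [mul_nonneg hNc0 hlogx0.le]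
    · exact hlo
  refine ⟨fun hno ↦ ?_, fun β₁ hζ hwin hβ1 ↦ ⟨fun hζE ↦ ?_, fun hζE ↦ ?_⟩⟩
  · have key := abs_le.1 (hA hno)
    have hM0 : 0 ≤ δC * h := by positivity
    rw [abs_le]; constructor <;> nlinarith [hsand.1, hsand.2, key.1, key.2, mul_pos hκ (mul_pos hδC0 hh0)]
  · obtain ⟨hflat, -⟩ := hB β₁ hζ hwin hβ1
    have key := abs_le.1 (hflat hζE)
    set M : ℝ := δC * (h - ((x + h) ^ β₁ - x ^ β₁) / β₁) with hM
    have hβ0 : 0 < β₁ := by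
      have hlogd : 0 < Real.log d := Real.log_pos (by linarith)
      have hlog4 : 1 < Real.log 4 := by
        rw [show (4:ℝ) = 2 ^ 2 by norm_num, Real.log_pow]; have := Real.log_two_gt_d9; push_cast; linarith
      have : c / (Real.log d + Real.log 4) ≤ 1 / 4 := by
        rw [div_le_iff₀ (by linarith)]; nlinarith
      linarith
    have hM0 : 0 ≤ M := by
      have hfl := half_min_mul_le_flat hx1.le hh0.le hβ0 hβ1
      have : 0 ≤ min 1 ((1 - β₁) * Real.log x) :=
        le_min zero_le_one (mul_nonneg (by linarith) (Real.log_nonneg hx1.le))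
      rw [hM]; exact mul_nonneg hδC0.le (by nlinarith)
    rw [abs_le]; constructor <;> nlinarith [hsand.1, hsand.2, key.1, key.2, mul_nonneg hκ.le hM0]
  · obtain ⟨-, hplus⟩ := hB β₁ hζ hwin hβ1
    have key := abs_le.1 (hplus hζE)
    have hβ0 : 0 < β₁ := by
      have hlogd : 0 < Real.log d := Real.log_pos (by linarith)
      have hlog4 : 1 < Real.log 4 := by
        rw [show (4:ℝ) = 2 ^ 2 by norm_num, Real.log_pow]; have := Real.log_two_gt_d9; push_cast; linarith
      have : c / (Real.log d + Real.log 4) ≤ 1 / 4 := by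
        rw [div_le_iff₀ (by linarith)]; nlinarith
      linarith
    obtain ⟨hI0, hIh⟩ := rpow_window_div_mem hx1.le hh0.le hβ0 hβ1.le
    have hI0' : 0 ≤ δC * (((x + h) ^ β₁ - x ^ β₁) / β₁) := mul_nonneg hδC0.le hI0
    have hIh' : δC * (((x + h) ^ β₁ - x ^ β₁) / β₁) ≤ δC * h := mul_le_mul_of_nonneg_left hIh hδC0.le
    have hΔup : ΔS ≤ 2 * (δC * h) + κ' * (δC * h) := by nlinarith [key.2]
    rw [abs_le]; constructor <;> nlinarith [hsand.1, hsand.2, key.1, key.2, mul_pos hκ (mul_pos hδC0 hh0)]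

end Summit.QuantumAdvantage.QuantumAdvantage.Theorems.DegreeOnePrimesEscape

end
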